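import Literature.AnabelianGeometry.SemiGraphs.Coverticial

/-!
# [SemiAnbd] Corollary 2.7 (iii) from Proposition 2.6; Prop. 2.6 clause 2 from clause 1 (proof-only companion of `Coverticial.lean`)

Mochizuki, *Semi-graphs of anabelioids*, Publ. RIMS **42** (2006) 221–322, §2, author's manuscript
pp. 28–30 [cite: MochizukiSemiAnbd2006, Prop. 2.6 p.28; Cor. 2.7(iii) p.30].  Kernel-checked printed
implications between the named facts of `Coverticial.lean` (abc-iut discharge companion; no new
definitions, statements untouched):

* `corollary_2_7_iii_of_proposition_2_6 : proposition_2_6 → corollary_2_7_iii` — p. 30: "assertion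
  (iii) is a formal consequence of Proposition 2.6";
* `not_commensurable_conj_of_relIndex_eq_zero` — the "In particular" clause of Proposition 2.6 (no
  conjugates commensurable) from its first clause (infinite index), for arbitrary subgroups.

Proposition 2.6 itself (first clause) is NOT proved here: its printed proof (pp. 28–29) needs the
covering theory of `B(𝒢)` (finite etale coverings attached to objects, their `Π_𝒢`-sets, the
`Π_v ⊆ Π_𝒢` dictionary of Remark 2.2.1), not yet in the tree.
-/
namespace Literature.AnabelianGeometry.SemiGraphs

open CategoryTheory
open scoped Pointwise

section GroupTheoryD1

variable {G G' : Type*} [Group G] [Group G']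

/-- Images of conjugates are conjugates of images. [folklore] -/
private theorem map_conjAct_smul_cov (e : G →* G') (g : G) (A : Subgroup G) :
    (ConjAct.toConjAct g • A).map e = ConjAct.toConjAct (e g) • A.map e := by
  ext y
  simp only [Subgroup.mem_map, Subgroup.mem_smul_pointwise_iff_exists, ConjAct.smul_def,
    ConjAct.ofConjAct_toConjAct]
  constructor
  · rintro ⟨x, ⟨s, hs, rfl⟩, rfl⟩
    exact ⟨e s, ⟨s, hs, rfl⟩, by simp [map_mul, map_inv]⟩
  · rintro ⟨x', ⟨s, hs, rfl⟩, rfl⟩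
    exact ⟨g * s * g⁻¹, ⟨s, hs, rfl⟩, by simp [map_mul, map_inv]⟩

/-- Commensurability is preserved under injective homomorphisms. [folklore] -/
private theorem commensurable_map_of_injective {f : G →* G'} (hf : Function.Injective f)
    {A B : Subgroup G} (h : Subgroup.Commensurable A B) :
    Subgroup.Commensurable (A.map f) (B.map f) := by
  unfold Subgroup.Commensurable at h ⊢
  rwa [Subgroup.relIndex_map_map_of_injective _ _ hf, Subgroup.relIndex_map_map_of_injective _ _ hf]

end GroupTheoryD1

namespace SemiGraphOfAnabelioids

universe v₁' u₁' u'

/-- Inverting the isomorphism of basepoints inverts the induced isomorphism of fundamental groups.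
[folklore] -/
private theorem autMulEquivOfIso_symm_apply {C : Type*} [Category C] {X Y : C} (h : X ≅ Y)
    (y : Aut Y) : (Aut.autMulEquivOfIso h).symm y = Aut.autMulEquivOfIso h.symm y := rfl

/-- **[SemiAnbd] Corollary 2.7 (iii) is "a formal consequence of Proposition 2.6"** (proof of
Cor. 2.7, last line, p. 30): the named fact `corollary_2_7_iii` follows from the named fact
`proposition_2_6`.  If `ℍ ≠ 𝕂`, some component of `ℍ` is not in `𝕂` or some component of `𝕂` is not in
`ℍ`; it is an elevated vertex or a sub-coverticial edge by hypothesis, so Proposition 2.6 (applied to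
`(ℍ, 𝕂)`, resp. to `(𝕂, ℍ)` after transporting along the isomorphism of basepoints) forbids the assumed
commensurability. [cite: MochizukiSemiAnbd2006, Cor. 2.7(iii) p.30] -/
theorem corollary_2_7_iii_of_proposition_2_6 (h26 : proposition_2_6.{v₁', u₁', u'}) :
    corollary_2_7_iii.{v₁', u₁', u'} := by
  intro 𝒢 hconn hgraph hqc H K hH hK hHg hKg hHv hKv hHe hKe w F _ w' F' _ α g hcomm
  by_contra hne
  -- a component of one subgraph missing from the other
  have hcases : (∃ v, v ∈ H.verts ∧ v ∉ K.verts) ∨ (∃ e, e ∈ H.edges ∧ e ∉ K.edges) ∨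
      (∃ v, v ∈ K.verts ∧ v ∉ H.verts) ∨ (∃ e, e ∈ K.edges ∧ e ∉ H.edges) := by
    by_contra hno
    push Not at hno
    obtain ⟨h1, h2, h3, h4⟩ := hno
    exact hne (SemiGraph.Subgraph.ext (Set.Subset.antisymm h1 h3) (Set.Subset.antisymm h2 h4))
  rcases hcases with hc | hc | hc | hc
  · -- an (elevated) vertex of `ℍ` not in `𝕂`
    obtain ⟨v, hvH, hvK⟩ := hc
    obtain ⟨-, h2⟩ := h26 𝒢 hconn hgraph hqc H K hH hK hHg hKg (Or.inl ⟨v, hvH, hvK, hHv v hvH⟩) w F w' F' α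
    have h3 := h2 1 g
    rw [map_one, one_smul] at h3
    exact h3 hcomm
  · -- a (sub-coverticial) edge of `ℍ` not in `𝕂`
    obtain ⟨e, heH, heK⟩ := hc
    obtain ⟨-, h2⟩ := h26 𝒢 hconn hgraph hqc H K hH hK hHg hKg (Or.inr ⟨e, heH, heK, hHe e heH⟩) w F w' F' α
    have h3 := h2 1 g
    rw [map_one, one_smul] at h3
    exact h3 hcomm
  · -- a vertex of `𝕂` not in `ℍ`: apply Prop. 2.6 to `(𝕂, ℍ)` and transport along `α.symm`
    obtain ⟨v, hvK, hvH⟩ := hc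
    obtain ⟨-, h2⟩ :=
      h26 𝒢 hconn hgraph hqc K H hK hH hKg hHg (Or.inl ⟨v, hvK, hvH, hKv v hvK⟩) w' F' w F α.symm
    apply h2 ((Aut.autMulEquivOfIso α).symm g) 1
    rw [map_one, one_smul]
    have ht := commensurable_map_of_injective
      (f := (Aut.autMulEquivOfIso α).symm.toMonoidHom) (Aut.autMulEquivOfIso α).symm.injective hcomm
    rw [map_conjAct_smul_cov, MonoidHom.map_range, MonoidHom.map_range] at ht
    have e1 : ((Aut.autMulEquivOfIso α).symm.toMonoidHom.comp
        ((Aut.autMulEquivOfIso α).toMonoidHom.comp (𝒢.piHToPi K w' F'))) = 𝒢.piHToPi K w' F' := by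
      ext x
      simp
    rw [e1] at ht
    exact ht.symm
  · -- an edge of `𝕂` not in `ℍ`
    obtain ⟨e, heK, heH⟩ := hc
    obtain ⟨-, h2⟩ :=
      h26 𝒢 hconn hgraph hqc K H hK hH hKg hHg (Or.inr ⟨e, heK, heH, hKe e heK⟩) w' F' w F α.symm
    apply h2 ((Aut.autMulEquivOfIso α).symm g) 1
    rw [map_one, one_smul]
    have ht := commensurable_map_of_injective
      (f := (Aut.autMulEquivOfIso α).symm.toMonoidHom) (Aut.autMulEquivOfIso α).symm.injective hcomm
    rw [map_conjAct_smul_cov, MonoidHom.map_range, MonoidHom.map_range] at ht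
    have e1 : ((Aut.autMulEquivOfIso α).symm.toMonoidHom.comp
        ((Aut.autMulEquivOfIso α).toMonoidHom.comp (𝒢.piHToPi K w' F'))) = 𝒢.piHToPi K w' F' := by
      ext x
      simp
    rw [e1] at ht
    exact ht.symm

/-- **[SemiAnbd] Proposition 2.6, "In particular"**: the second printed conclusion ("no conjugate of
`Π_ℍ` is commensurable to a conjugate of `Π_𝕂`") follows from the first ("the intersection of `Π_ℍ`
with any conjugate of `Π_𝕂` has infinite index in `Π_ℍ`"), for any two subgroups: if
`g Π_ℍ g⁻¹` were commensurable with `g' Π_𝕂 g'⁻¹`, then `Π_ℍ ∩ (g⁻¹g') Π_𝕂 (g⁻¹g')⁻¹` would have finite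
index in `Π_ℍ`. [cite: MochizukiSemiAnbd2006, Prop. 2.6 p.28] -/
theorem not_commensurable_conj_of_relIndex_eq_zero {Γ : Type*} [Group Γ] {PH PK : Subgroup Γ}
    (h : ∀ g : Γ, (ConjAct.toConjAct g • PK).relIndex PH = 0) (g g' : Γ) :
    ¬ Subgroup.Commensurable (ConjAct.toConjAct g • PH) (ConjAct.toConjAct g' • PK) := by
  intro hc
  have hc' := hc.conj (ConjAct.toConjAct g)⁻¹
  rw [smul_smul, inv_mul_cancel, one_smul, smul_smul, ← map_inv, ← map_mul] at hc'
  exact hc'.2 (h (g⁻¹ * g'))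

end SemiGraphOfAnabelioids

end Literature.AnabelianGeometry.SemiGraphs
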